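import Literature.MathematicalPhysics.QuantumManyBody.BoseGasHardCoreContact
import Literature.MathematicalPhysics.QuantumManyBody.PeriodicMultiplierKineticBound
import Literature.MathematicalPhysics.QuantumManyBody.GroundStateFeynmanKacFreeForm
import HarnessLib

/-!
# Crux `GroundStateRigidity` (stmt-AtomisticToContinuum-9072), line `Sketch`:
# the registered stub `stub_shellMassOfCutoff`

Supports (does not close) stmt-AtomisticToContinuum-9072; registered stub `stub_shellMassOfCutoff`
(Stub 15b) of line Sketch (lead c4). **Mass in the outer contact shell of one pair.** For a `C¹`
wave function `ψ`, a pair `i ≠ j`, `0 < s`, `81 s ≤ b` and a `C¹` cutoff `η ∈ [0,1]` with `η = 0`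
where some pair is `≤ b - s`, `η = 1` where all pairs are `≥ b`, and `|∇η|² ≤ (A/s²) 1_{layer}`
(layer: some pair in `(b - s, b)`):

  `∫ 1{b < |xᵢ-xⱼ| < b+3s} |ψ|² ≤ 288 s² ∫ 1{b-s < |xᵢ-xⱼ| < b+3s} |∇ψ|²
      + (288 A + 1) ∫ 1{some pair < b} |ψ|²`.

## Proof

Apply the one-pair shell Poincaré estimate `lintegral_shellPair_le` of
`BoseGasHardCoreContact.lean` (contact radius `a = b - s`, width `δ = 4s`; `20 δ ≤ a ⇔ 81 s ≤ b`)
to the cut state `φ = η ψ`, which is `C¹` and vanishes where some pair is `≤ b - s`: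
`∫ 1_{shell(b-s,4s)} |φ|² ≤ 9 (4s)² ∫ 1_{shell(b-s,4s)} ∑ₖ |∂_{ik} φ|²`. Pointwise,
`1_{shell(b,3s)} |ψ|² ≤ 1_{shell(b-s,4s)} |φ|² + 1_{some pair < b} |ψ|²` (if all pairs are `≥ b`
then `η = 1`, `φ = ψ` and `shell(b,3s) ⊆ shell(b-s,4s)`; `ShellMass.indicator_outer_le`), and by
the IMS/Young multiplier bound `kineticDensity_ofReal_mul_le` (with `θ = 1`)
`∑ₖ |∂_{ik} φ|² ≤ |∇φ|² ≤ 2 |∇ψ|² + 2 |ψ|² |∇η|² ≤ 2 |∇ψ|² + 2 (A/s²) 1_{some pair < b} |ψ|²`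
(`ShellMass.grad_pt`). Integrating, `9 · 16 · 2 = 288` and `144 s² · 2 A/s² = 288 A`.
-/

noncomputable section

open MeasureTheory Set
open scoped ENNReal NNReal

namespace Summit.AtomisticToContinuum.BoseEinsteinCondensation.Theorems.GroundStateRigidity

open Literature.MathematicalPhysics.QuantumManyBody.BoseGas

namespace ShellMass

variable {N : ℕ}

/-- **Pointwise covering of the outer shell.** If `η = 1` wherever all pairs are `≥ b` apart and
`0 < s`, then `1_{shell(b,3s)} |ψ|² ≤ 1_{shell(b-s,4s)} |η ψ|² + 1_{some pair < b} |ψ|²`: either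
some pair is `< b`, or `η = 1` at the point and `shell(b,3s) ⊆ shell(b-s,4s)`. [folklore] -/
theorem indicator_outer_le {b s : ℝ} {η : Config N → ℝ}
    (hη1 : ∀ X : Config N, (∀ i' j' : Fin N, i' ≠ j' → b ≤ dist (X i') (X j')) → η X = 1)
    (hs : 0 < s) (ψ : Config N → ℂ) (i j : Fin N) (X : Config N) :
    (shellPair b (3 * s) i j).indicator (fun Y => (‖ψ Y‖₊ : ℝ≥0∞) ^ 2) X ≤
      (shellPair (b - s) (4 * s) i j).indicator
          (fun Y => (‖(η Y : ℂ) * ψ Y‖₊ : ℝ≥0∞) ^ 2) X +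
        {Y : Config N | ∃ i' j' : Fin N, i' ≠ j' ∧ dist (Y i') (Y j') < b}.indicator
          (fun Y => (‖ψ Y‖₊ : ℝ≥0∞) ^ 2) X := by
  by_cases hX : X ∈ shellPair b (3 * s) i j
  · rw [indicator_of_mem hX]
    by_cases hK : ∃ i' j' : Fin N, i' ≠ j' ∧ dist (X i') (X j') < b
    · rw [indicator_of_mem
        (show X ∈ {Y : Config N | ∃ i' j' : Fin N, i' ≠ j' ∧ dist (Y i') (Y j') < b} from hK)]
      exact le_add_self
    · have hfar : ∀ i' j' : Fin N, i' ≠ j' → b ≤ dist (X i') (X j') :=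
        fun i' j' hij' => not_lt.1 fun h => hK ⟨i', j', hij', h⟩
      have hX' : X ∈ shellPair (b - s) (4 * s) i j :=
        ⟨by linarith [hX.1], by linarith [hX.2]⟩
      rw [indicator_of_mem hX', hη1 X hfar, Complex.ofReal_one, one_mul]
      exact le_self_add
  · rw [indicator_of_notMem hX]
    exact zero_le

/-- **Pointwise gradient bound for the cut state** `φ = η ψ` in the directions of particle `i`:
`∑ₖ |∂_{ik} φ|² ≤ 2 |∇ψ|² + 2 (A/s²) 1_{some pair < b} |ψ|²` (the `i`-th block of `|∇φ|²`, the
IMS/Young multiplier bound `kineticDensity_ofReal_mul_le` with `θ = 1`, `η² ≤ 1`,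
`|∇η|² ≤ (A/s²) 1_{layer}` and layer `⊆ {some pair < b}`). [cite: LSSY2005, proof of Thm 2.4] -/
theorem grad_pt {b s : ℝ} {A : ℝ≥0} {η : Config N → ℝ} {ψ : Config N → ℂ}
    (hη : ContDiff ℝ 1 η) (hη01 : ∀ X, 0 ≤ η X ∧ η X ≤ 1)
    (hA : ∀ X : Config N, realKinetic η X ≤
        {Y : Config N | ∃ i' j' : Fin N, i' ≠ j' ∧ b - s < dist (Y i') (Y j') ∧
            dist (Y i') (Y j') < b}.indicator (fun _ => ENNReal.ofReal ((A : ℝ) / s ^ 2)) X)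
    (hψ : ContDiff ℝ 1 ψ) (i : Fin N) (X : Config N) :
    ∑ k : Fin 3, (‖fderiv ℝ (fun Y => (η Y : ℂ) * ψ Y) X (unitVec i k)‖₊ : ℝ≥0∞) ^ 2 ≤
      2 * kineticDensity ψ X + 2 * ENNReal.ofReal ((A : ℝ) / s ^ 2) *
        {Y : Config N | ∃ i' j' : Fin N, i' ≠ j' ∧ dist (Y i') (Y j') < b}.indicator
          (fun Y => (‖ψ Y‖₊ : ℝ≥0∞) ^ 2) X := by
  have hψd : Differentiable ℝ ψ := hψ.differentiable one_ne_zero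
  have hηd : Differentiable ℝ η := hη.differentiable one_ne_zero
  -- the `i`-th block of the kinetic density of the product
  have hsum : (∑ k : Fin 3,
      (‖fderiv ℝ (fun Y => (η Y : ℂ) * ψ Y) X (unitVec i k)‖₊ : ℝ≥0∞) ^ 2) ≤
        kineticDensity (fun Y => (η Y : ℂ) * ψ Y) X := by
    unfold kineticDensity
    exact Finset.single_le_sum (f := fun i' : Fin N => ∑ k : Fin 3,
      (‖fderiv ℝ (fun Y => (η Y : ℂ) * ψ Y) X
        (Pi.single i' (EuclideanSpace.single k (1 : ℝ)))‖₊ : ℝ≥0∞) ^ 2)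
      (fun _ _ => zero_le) (Finset.mem_univ i)
  refine hsum.trans ((kineticDensity_ofReal_mul_le (hψd X) (hηd X) one_pos).trans ?_)
  refine add_le_add ?_ ?_
  · -- `(1 + 1) η² ≤ 2`
    refine mul_le_mul' ?_ le_rfl
    rw [← ENNReal.ofReal_ofNat 2]
    refine ENNReal.ofReal_le_ofReal ?_
    have h01 := hη01 X
    nlinarith [h01.1, h01.2]
  · -- `2 |ψ|² |∇η|² ≤ 2 (A/s²) 1_{some pair < b} |ψ|²`
    rw [kineticDensity_ofReal hηd X, show (1 : ℝ) + 1⁻¹ = 2 by norm_num, ENNReal.ofReal_ofNat]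
    have hAX := hA X
    by_cases hXT : X ∈ {Y : Config N | ∃ i' j' : Fin N, i' ≠ j' ∧ b - s < dist (Y i') (Y j') ∧
        dist (Y i') (Y j') < b}
    · rw [indicator_of_mem hXT] at hAX
      obtain ⟨i', j', hij', -, hlt⟩ := hXT
      rw [indicator_of_mem
        (show X ∈ {Y : Config N | ∃ i' j' : Fin N, i' ≠ j' ∧ dist (Y i') (Y j') < b} from
          ⟨i', j', hij', hlt⟩)]
      calc 2 * (‖ψ X‖₊ : ℝ≥0∞) ^ 2 * realKinetic η X
          ≤ 2 * (‖ψ X‖₊ : ℝ≥0∞) ^ 2 * ENNReal.ofReal ((A : ℝ) / s ^ 2) :=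
            mul_le_mul' le_rfl hAX
        _ = 2 * ENNReal.ofReal ((A : ℝ) / s ^ 2) * (‖ψ X‖₊ : ℝ≥0∞) ^ 2 := by ring
    · rw [indicator_of_notMem hXT, nonpos_iff_eq_zero] at hAX
      rw [hAX, mul_zero]
      exact zero_le

end ShellMass

/-! ### The stub -/

open ShellMass in
/-- **Stub `stub_shellMassOfCutoff` of line `Sketch` (15b) — mass in the outer contact shell.**
For `ψ ∈ C¹`, `i ≠ j`, `0 < s`, `81 s ≤ b` and a `C¹` cutoff `η ∈ [0,1]` vanishing where some pair
is `≤ b - s`, equal to `1` where all pairs are `≥ b`, with `|∇η|² ≤ (A/s²) 1_{some pair ∈ (b-s,b)}`: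
`∫ 1{b < |xᵢ-xⱼ| < b+3s} |ψ|² ≤ 288 s² ∫ 1{b-s < |xᵢ-xⱼ| < b+3s} |∇ψ|² + (288 A + 1) ∫ 1{some
pair < b} |ψ|²`. Shell Poincaré estimate `lintegral_shellPair_le` (radius `b - s`, width `4s`)
for the cut state `η ψ`, the covering `indicator_outer_le` and the multiplier bound `grad_pt`;
`9 (4s)² · 2 = 288 s²`, `9 (4s)² · 2 A/s² = 288 A`. [cite: LSSY2005, proof of Thm 2.4] -/
theorem stub_shellMassOfCutoff :
    ∀ (N : ℕ) (b s : ℝ) (A : ℝ≥0) (η : Config N → ℝ) (ψ : Config N → ℂ) (i j : Fin N), i ≠ j →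
      0 < s → 81 * s ≤ b → ContDiff ℝ 1 η → (∀ X, 0 ≤ η X ∧ η X ≤ 1) →
      (∀ X : Config N, (∃ i' j' : Fin N, i' ≠ j' ∧ dist (X i') (X j') ≤ b - s) → η X = 0) →
      (∀ X : Config N, (∀ i' j' : Fin N, i' ≠ j' → b ≤ dist (X i') (X j')) → η X = 1) →
      (∀ X : Config N, realKinetic η X ≤
        {Y : Config N | ∃ i' j' : Fin N, i' ≠ j' ∧ b - s < dist (Y i') (Y j') ∧
            dist (Y i') (Y j') < b}.indicator (fun _ => ENNReal.ofReal ((A : ℝ) / s ^ 2)) X) →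
      ContDiff ℝ 1 ψ →
      ∫⁻ X, (shellPair b (3 * s) i j).indicator (fun Y => (‖ψ Y‖₊ : ℝ≥0∞) ^ 2) X ≤
        ENNReal.ofReal (288 * s ^ 2) *
            (∫⁻ X, (shellPair (b - s) (4 * s) i j).indicator (kineticDensity ψ) X) +
          (288 * (A : ℝ≥0∞) + 1) *
            ∫⁻ X, {Y : Config N | ∃ i' j' : Fin N, i' ≠ j' ∧ dist (Y i') (Y j') < b}.indicator
              (fun Y => (‖ψ Y‖₊ : ℝ≥0∞) ^ 2) X := by
  intro N b s A η ψ i j hij hs hsb hη hη01 hη0 hη1 hA hψ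
  -- the cut state, the core set, the density
  set φ : Config N → ℂ := fun Y => (η Y : ℂ) * ψ Y
  set K : Set (Config N) := {Y | ∃ i' j' : Fin N, i' ≠ j' ∧ dist (Y i') (Y j') < b}
  set F : Config N → ℝ≥0∞ := fun Y => (‖ψ Y‖₊ : ℝ≥0∞) ^ 2
  have hφC : ContDiff ℝ 1 φ := (Complex.ofRealCLM.contDiff.comp hη).mul hψ
  have ha : 0 < b - s := by linarith
  have hδ : 0 < 4 * s := by linarith
  have hδa : 20 * (4 * s) ≤ b - s := by linarith
  have hzero : ∀ X : Config N, ∀ i' j' : Fin N, i' ≠ j' → dist (X i') (X j') ≤ b - s →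
      φ X = 0 := by
    intro X i' j' hij' hd
    show (η X : ℂ) * ψ X = 0
    rw [hη0 X ⟨i', j', hij', hd⟩, Complex.ofReal_zero, zero_mul]
  -- the shell Poincaré estimate for the cut state
  have hshell := lintegral_shellPair_le ha hδ hδa hφC hzero hij
  -- measurability
  have hKm : MeasurableSet K := (isOpen_coreSet : IsOpen (coreSet b N)).measurableSet
  have hm1 : Measurable fun X => (shellPair (b - s) (4 * s) i j).indicator
      (fun Y => (‖φ Y‖₊ : ℝ≥0∞) ^ 2) X :=
    (measurable_ennnormSq hφC.continuous).indicator (measurableSet_shellPair _ _ i j)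
  have hm2 : Measurable fun X => (shellPair (b - s) (4 * s) i j).indicator (kineticDensity ψ) X :=
    (measurable_kineticDensity_any ψ).indicator (measurableSet_shellPair _ _ i j)
  have hm2' : Measurable fun X =>
      2 * (shellPair (b - s) (4 * s) i j).indicator (kineticDensity ψ) X := hm2.const_mul 2
  have hm3 : Measurable fun X => K.indicator F X :=
    (measurable_ennnormSq hψ.continuous).indicator hKm
  -- constants
  have hs0 : s ≠ 0 := hs.ne'
  have hc1 : ENNReal.ofReal (9 * (4 * s) ^ 2) * 2 = ENNReal.ofReal (288 * s ^ 2) := by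
    rw [← ENNReal.ofReal_ofNat 2, ← ENNReal.ofReal_mul (by positivity)]
    congr 1
    ring
  have hc2 : ENNReal.ofReal (9 * (4 * s) ^ 2) * (2 * ENNReal.ofReal ((A : ℝ) / s ^ 2)) =
      288 * (A : ℝ≥0∞) := by
    rw [← ENNReal.ofReal_ofNat 2, ← ENNReal.ofReal_mul (by positivity),
      ← ENNReal.ofReal_mul (by positivity), ← ENNReal.ofReal_coe_nnreal,
      ← ENNReal.ofReal_ofNat 288, ← ENNReal.ofReal_mul (by positivity)]
    congr 1
    field_simp
    ring
  calc ∫⁻ X, (shellPair b (3 * s) i j).indicator F X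
      ≤ ∫⁻ X, ((shellPair (b - s) (4 * s) i j).indicator (fun Y => (‖φ Y‖₊ : ℝ≥0∞) ^ 2) X +
          K.indicator F X) :=
        lintegral_mono fun X => indicator_outer_le hη1 hs ψ i j X
    _ = (∫⁻ X, (shellPair (b - s) (4 * s) i j).indicator (fun Y => (‖φ Y‖₊ : ℝ≥0∞) ^ 2) X) +
          ∫⁻ X, K.indicator F X := lintegral_add_left hm1 _
    _ ≤ ENNReal.ofReal (9 * (4 * s) ^ 2) * (∫⁻ X, (shellPair (b - s) (4 * s) i j).indicator
          (fun Y => ∑ k : Fin 3, (‖fderiv ℝ φ Y (unitVec i k)‖₊ : ℝ≥0∞) ^ 2) X) +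
          ∫⁻ X, K.indicator F X := add_le_add hshell le_rfl
    _ ≤ ENNReal.ofReal (9 * (4 * s) ^ 2) * (∫⁻ X, (2 * (shellPair (b - s) (4 * s) i j).indicator
          (kineticDensity ψ) X + 2 * ENNReal.ofReal ((A : ℝ) / s ^ 2) * K.indicator F X)) +
          ∫⁻ X, K.indicator F X := by
        refine add_le_add (mul_le_mul' le_rfl (lintegral_mono fun X => ?_)) le_rfl
        by_cases hX : X ∈ shellPair (b - s) (4 * s) i j
        · rw [indicator_of_mem hX, indicator_of_mem hX]
          exact grad_pt hη hη01 hA hψ i X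
        · rw [indicator_of_notMem hX]
          exact zero_le
    _ = ENNReal.ofReal (9 * (4 * s) ^ 2) * (2 * (∫⁻ X, (shellPair (b - s) (4 * s) i j).indicator
          (kineticDensity ψ) X) + 2 * ENNReal.ofReal ((A : ℝ) / s ^ 2) * ∫⁻ X, K.indicator F X) +
          ∫⁻ X, K.indicator F X := by
        rw [lintegral_add_left hm2', lintegral_const_mul _ hm2, lintegral_const_mul _ hm3]
    _ = ENNReal.ofReal (9 * (4 * s) ^ 2) * 2 * (∫⁻ X, (shellPair (b - s) (4 * s) i j).indicator
          (kineticDensity ψ) X) +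
          (ENNReal.ofReal (9 * (4 * s) ^ 2) * (2 * ENNReal.ofReal ((A : ℝ) / s ^ 2)) + 1) *
            ∫⁻ X, K.indicator F X := by ring
    _ = _ := by rw [hc1, hc2]

end Summit.AtomisticToContinuum.BoseEinsteinCondensation.Theorems.GroundStateRigidity

end
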